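import Literature.NumberTheory.Automorphic.KirillovDilationMoments
import Literature.NumberTheory.Automorphic.SmoothedFormWhittakerLine
import Literature.NumberTheory.Automorphic.AutomorphicGLnWhittakerSobolev
import Literature.NumberTheory.Automorphic.AutomorphicRepsGLCuspidalL2Step1KFinite
import HarnessLib

/-!
# The Kirillov `L²`-bound along the archimedean torus for `GL_2` (soft form of Jacquet–Shalika §4)

Topic `NumberTheory/Automorphic`; namespace `Literature.NumberTheory.Automorphic`. Proof file
(theorems only). For a closed subrepresentation `W ≤ L²(GL_2(K) A_G \ GL_2(𝔸_K))`, `f ∈ W` and a test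
function `θ` left-invariant under `(1, U₀)`, `U₀ ≤ GL_2(𝔸_{K,f})` compact open, consider the global
Whittaker coefficient of the smoothed form `S_θ f` (Tate's character and box) along the archimedean
torus `a(y) = (diag(y,1), 1)`, `y ∈ K_∞ˣ`. We PROVE the **Kirillov `L²`-bound**

  `∫_{K_∞ˣ} |W_{S_θ f}(a(y))|² d^×y ≤ C · ∑_{u ∈ 𝒰} ‖S_{θ_u} f‖²`

(`exists_lintegral_norm_sq_whittakerCoeff_archDilation_le`) with a finite constant `C` and a finite set
`𝒰` of archimedean words depending only on `U₀` (and on fixed auxiliary choices), NOT on `W`, `θ`, `f`: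
the Kirillov norm of a Gårding vector along the archimedean torus is controlled by finitely many
Sobolev norms. This is the archimedean local input of the Rankin–Selberg theory of `GL_2` at
`s = 1` (Jacquet–Shalika (1981), §4: square-integrability of Whittaker functions of unitary generic
representations on `N\P`; the `GL_2(ℝ)` Kirillov model, Bump (1997), §2.8), obtained here softly:
`W_{S_θ f}(a(y)) = Λ(S_{L_{a(y)}θ} f) = ĝ₀(1)⁻¹ Λ(S_{g₀ ⋆ L_{a(y)}θ} f)` for an admissible kernel `g₀`
(`whittakerCoeff_smoothedForm_archUnipotentConv`, `exists_isMomentKernelGE_kernelTransform_one_ne_zero`);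
the Sobolev bound of the Whittaker functional (`norm_whittakerCoeff_sum_invQuot_smoothedForm_le`);
the word expansion (`isDilRepresentable_wordDerivWeight_dilAtom`); the dilation integral of each atom
(`lintegral_placeWeight_mul_norm_sq_smoothedVector_dilAtom_le`) and the moments of the spectral
measures of the fixed vectors `S_{θ_u} f` (`lintegral_placeWeight_spectralMeasure_smoothedVector_le`).

## References

* H. Jacquet, J. A. Shalika, *On Euler products and the classification of automorphic
  representations I*, Amer. J. Math. 103 (1981), §4 [JacquetShalikaAJM1981].
* D. Bump, *Automorphic Forms and Representations* (1997), §2.8 [Bump1997].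
* J. W. Cogdell, *Analytic theory of L-functions for GL_n*, in *An Introduction to the Langlands
  Program* (2004), §1.1, Thm. 3.2 (1) [CogdellAnalyticTheory2004].
-/

noncomputable section

open scoped MatrixGroups Classical ENNReal NNReal ComplexConjugate
open NumberField NumberField.mixedEmbedding NumberField.InfinitePlace IsDedekindDomain MeasureTheory Complex
open Literature.Analysis.UnboundedOperators Real

namespace Literature.NumberTheory.Automorphic

variable {K : Type} [Field K] [NumberField K]
  {μ : Measure (AdelicGroupData.gl 2 K).automorphicQuotient} [(AdelicGroupData.gl 2 K).IsAutomorphicMeasure μ]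

attribute [local instance] adelicBorel borelSpace_adelic locallyCompactSpace_adelic
  secondCountableTopology_gl_adelic

attribute [local instance] Literature.MeasureTheory.Group.Units.borelSpace_of_isOpenEmbedding
  Literature.MeasureTheory.Group.hasSummableGeomSeries_of_finiteDimensional

set_option backward.isDefEq.respectTransparency false
set_option synthInstance.maxHeartbeats 400000

attribute [local instance 100] LieRing.ofAssociativeRing

open scoped Matrix.Norms.Operator

/-! ### Invariance and continuity of atoms -/

/-- Left `(1, U₀)`-invariance passes to archimedean left translates (the archimedean torus commutes
with `GL_2(𝔸_f)`). [folklore] -/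
theorem leftTranslateWeight_archDilation_ofFinite_mul {U₀ : Subgroup (GL (Fin 2) (FiniteAdeleRing (𝓞 K) K))}
    {θ : GL (Fin 2) (AdeleRing (𝓞 K) K) → ℝ} (hθU : ∀ u ∈ U₀, ∀ g, θ (GLn.ofFinite 2 K u * g) = θ g) (y : (mixedSpace K)ˣ)
    (u : GL (Fin 2) (FiniteAdeleRing (𝓞 K) K)) (hu : u ∈ U₀) (g : GL (Fin 2) (AdeleRing (𝓞 K) K)) :
    leftTranslateWeight (n := 2) (archDilationGL K y) θ (GLn.ofFinite 2 K u * g) = leftTranslateWeight (n := 2) (archDilationGL K y) θ g := by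
  simp only [leftTranslateWeight_apply]
  have hc : (archDilationGL K y)⁻¹ * GLn.ofFinite 2 K u = GLn.ofFinite 2 K u * (archDilationGL K y)⁻¹ := by
    rw [archDilationGL, archDilationAdelic, ← map_inv]
    exact (GLn.commute_ofInfinite_ofFinite _ u).eq
  show θ ((archDilationGL K y)⁻¹ * (GLn.ofFinite 2 K u * g)) = θ ((archDilationGL K y)⁻¹ * g)
  rw [← mul_assoc, hc, mul_assoc, hθU u hu]

/-- **Atoms of a left `(1, U₀)`-invariant weight are left `(1, U₀)`-invariant.** [folklore] -/
theorem dilAtom_ofFinite_mul {U₀ : Subgroup (GL (Fin 2) (FiniteAdeleRing (𝓞 K) K))}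
    {θ : GL (Fin 2) (AdeleRing (𝓞 K) K) → ℝ} (hθU : ∀ u ∈ U₀, ∀ g, θ (GLn.ofFinite 2 K u * g) = θ g) (g₀ : mixedSpace K → ℝ)
    (y : (mixedSpace K)ˣ) (u : GL (Fin 2) (FiniteAdeleRing (𝓞 K) K)) (hu : u ∈ U₀) (g : GL (Fin 2) (AdeleRing (𝓞 K) K)) :
    dilAtom g₀ θ y (GLn.ofFinite 2 K u * g) = dilAtom g₀ θ y g :=
  archUnipotentConv_ofFinite_mul (fun u hu g => leftTranslateWeight_archDilation_ofFinite_mul hθU y u hu g) g₀ u hu g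

omit [NumberField K] in
/-- A `2 × 2` matrix-valued map is continuous if its four entries are. [folklore] -/
theorem continuous_matrix_two {X : Type*} [TopologicalSpace X] {R : Type*} [TopologicalSpace R]
    {a b c d : X → R} (ha : Continuous a) (hb : Continuous b) (hc : Continuous c) (hd : Continuous d) :
    Continuous fun x => !![a x, b x; c x, d x] := by
  refine continuous_matrix fun i j => ?_
  fin_cases i <;> fin_cases j
  · exact ha
  · exact hb
  · exact hc
  · exact hd

omit [NumberField K] in
/-- `y ↦ diag(y, 1)` is continuous on `K_∞ˣ`. [folklore] -/
theorem continuous_diagGL2_one : Continuous fun y : (mixedSpace K)ˣ => (diagGL2 y 1 : GL (Fin 2) (mixedSpace K)) := by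
  refine Units.continuous_iff.2 ⟨?_, ?_⟩
  · have h : (Units.val ∘ fun y : (mixedSpace K)ˣ => (diagGL2 y 1 : GL (Fin 2) (mixedSpace K))) =
        fun y : (mixedSpace K)ˣ => !![((y : (mixedSpace K)ˣ) : mixedSpace K), 0; 0, ((1 : (mixedSpace K)ˣ) : mixedSpace K)] := by
      funext y; exact coe_diagGL2 y 1
    rw [h]
    exact continuous_matrix_two Units.continuous_val continuous_const continuous_const continuous_const
  · have h : (fun y : (mixedSpace K)ˣ => (((diagGL2 y 1 : GL (Fin 2) (mixedSpace K))⁻¹ : GL (Fin 2) (mixedSpace K)) :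
        Matrix (Fin 2) (Fin 2) (mixedSpace K))) =
        fun y : (mixedSpace K)ˣ => !![((y⁻¹ : (mixedSpace K)ˣ) : mixedSpace K), 0; 0, ((1 : (mixedSpace K)ˣ) : mixedSpace K)] := by
      funext y
      have hinv : (diagGL2 y 1 : GL (Fin 2) (mixedSpace K))⁻¹ = diagGL2 y⁻¹ 1 := by
        rw [inv_eq_iff_mul_eq_one, ← show diagGL2 (y * y⁻¹) ((1 : (mixedSpace K)ˣ) * 1) =
          diagGL2 y 1 * diagGL2 y⁻¹ 1 from diagGL2_mul y 1 y⁻¹ 1, mul_inv_cancel, mul_one, diagGL2_one]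
      rw [hinv]; exact coe_diagGL2 y⁻¹ 1
    rw [h]
    exact continuous_matrix_two Units.continuous_coe_inv continuous_const continuous_const continuous_const

/-- `y ↦ a(y) = (diag(y,1), 1)` is continuous. [folklore] -/
theorem continuous_archDilationAdelic : Continuous (archDilationAdelic K) :=
  (GLn.continuous_ofInfinite 2 K).comp continuous_diagGL2_one

/-- Strong continuity of the torus action: `y ↦ R(a(y)) v` is continuous. [folklore] -/
theorem continuous_rightRegular_archDilation (v : (AdelicGroupData.gl 2 K).L2 μ) :
    Continuous fun y : (mixedSpace K)ˣ => (AdelicGroupData.gl 2 K).rightRegular μ (archDilationAdelic K y) v :=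
  ((AdelicGroupData.isStronglyContinuous_rightRegular_holds (AdelicGroupData.gl 2 K) μ) v).comp continuous_archDilationAdelic

variable (W : ContRepresentation.ClosedSubrep ((AdelicGroupData.gl 2 K).rightRegular μ))

/-- **The smoothed vector of an atom depends continuously on the torus variable** (in `L²`). [folklore] -/
theorem continuous_smoothedVector_dilAtom {g : mixedSpace K → ℝ} (hg : Continuous g) (hgs : HasCompactSupport g)
    {θ : GL (Fin 2) (AdeleRing (𝓞 K) K) → ℝ} (hθ : IsTestFunctionGL 2 K θ) (f : W.toSubmodule) :
    Continuous fun y : (mixedSpace K)ˣ => (smoothedVector W (dilAtom g θ y) f : (AdelicGroupData.gl 2 K).L2 μ) := by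
  set v : (AdelicGroupData.gl 2 K).L2 μ := (smoothedVector W θ f : (AdelicGroupData.gl 2 K).L2 μ) with hv
  have heq : (fun y : (mixedSpace K)ˣ => (smoothedVector W (dilAtom g θ y) f : (AdelicGroupData.gl 2 K).L2 μ)) =
      fun y => ∫ x, (g x : ℂ) • (AdelicGroupData.gl 2 K).rightRegular μ (archUnipotentAdelic K x) ((AdelicGroupData.gl 2 K).rightRegular μ (archDilationAdelic K y) v) := by
    funext y; exact coe_smoothedVector_dilAtom W hg hgs hθ f y
  rw [heq]
  have hgi : Integrable (fun x => |g x|) (volume : Measure (mixedSpace K)) :=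
    (hg.integrable_of_hasCompactSupport hgs).abs
  set I : ℝ := ∫ x, |g x| with hI
  have hRv : Continuous fun y : (mixedSpace K)ˣ => (AdelicGroupData.gl 2 K).rightRegular μ (archDilationAdelic K y) v := continuous_rightRegular_archDilation v
  -- integrability of the integrands
  have hint : ∀ w : (AdelicGroupData.gl 2 K).L2 μ, Integrable (fun x => (g x : ℂ) • (AdelicGroupData.gl 2 K).rightRegular μ (archUnipotentAdelic K x) w) := fun w =>
    ((continuous_ofReal.comp hg).smul (continuous_rightRegular_archUnipotent μ w)).integrable_of_hasCompactSupport
      (hgs.comp_left ofReal_zero).smul_right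
  -- the Lipschitz-type bound `‖F y - F y₀‖ ≤ I ‖R(a y) v - R(a y₀) v‖`
  have hbd : ∀ y y₀ : (mixedSpace K)ˣ,
      ‖(∫ x, (g x : ℂ) • (AdelicGroupData.gl 2 K).rightRegular μ (archUnipotentAdelic K x) ((AdelicGroupData.gl 2 K).rightRegular μ (archDilationAdelic K y) v)) -
          ∫ x, (g x : ℂ) • (AdelicGroupData.gl 2 K).rightRegular μ (archUnipotentAdelic K x) ((AdelicGroupData.gl 2 K).rightRegular μ (archDilationAdelic K y₀) v)‖ ≤
        I * ‖(AdelicGroupData.gl 2 K).rightRegular μ (archDilationAdelic K y) v - (AdelicGroupData.gl 2 K).rightRegular μ (archDilationAdelic K y₀) v‖ := by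
    intro y y₀
    rw [← integral_sub (hint _) (hint _)]
    have h1 : ∀ x, (g x : ℂ) • (AdelicGroupData.gl 2 K).rightRegular μ (archUnipotentAdelic K x) ((AdelicGroupData.gl 2 K).rightRegular μ (archDilationAdelic K y) v) -
        (g x : ℂ) • (AdelicGroupData.gl 2 K).rightRegular μ (archUnipotentAdelic K x) ((AdelicGroupData.gl 2 K).rightRegular μ (archDilationAdelic K y₀) v) =
        (g x : ℂ) • (AdelicGroupData.gl 2 K).rightRegular μ (archUnipotentAdelic K x) ((AdelicGroupData.gl 2 K).rightRegular μ (archDilationAdelic K y) v - (AdelicGroupData.gl 2 K).rightRegular μ (archDilationAdelic K y₀) v) := fun x => by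
      rw [map_sub, smul_sub]
    simp_rw [h1]
    refine (norm_integral_le_integral_norm _).trans (le_of_eq ?_)
    rw [hI, ← integral_mul_const]
    refine integral_congr_ae (ae_of_all _ fun x => ?_)
    show ‖(g x : ℂ) • _‖ = |g x| * _
    rw [_root_.norm_smul, Complex.norm_real, Real.norm_eq_abs, norm_rightRegular_archUnipotent]
  refine continuous_iff_continuousAt.2 fun y₀ => ?_
  rw [ContinuousAt, tendsto_iff_norm_sub_tendsto_zero]
  have hlim : Filter.Tendsto (fun y : (mixedSpace K)ˣ => I * ‖(AdelicGroupData.gl 2 K).rightRegular μ (archDilationAdelic K y) v - (AdelicGroupData.gl 2 K).rightRegular μ (archDilationAdelic K y₀) v‖)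
      (nhds y₀) (nhds 0) := by
    have hc : Continuous fun y : (mixedSpace K)ˣ => I * ‖(AdelicGroupData.gl 2 K).rightRegular μ (archDilationAdelic K y) v -
        (AdelicGroupData.gl 2 K).rightRegular μ (archDilationAdelic K y₀) v‖ :=
      continuous_const.mul (hRv.sub continuous_const).norm
    have h := hc.tendsto y₀
    rwa [sub_self, norm_zero, mul_zero] at h
  exact squeeze_zero (fun y => norm_nonneg _) (fun y => hbd y y₀) hlim

/-- The torus profile `y ↦ ∏|y_w|^{2m_w} ‖S_{g ⋆ L_{a(y)} θ} f‖²` of an atom is measurable. [folklore] -/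
theorem measurable_placeWeight_mul_norm_sq_smoothedVector_dilAtom {g : mixedSpace K → ℝ} (hg : Continuous g)
    (hgs : HasCompactSupport g) {θ : GL (Fin 2) (AdeleRing (𝓞 K) K) → ℝ} (hθ : IsTestFunctionGL 2 K θ) (f : W.toSubmodule)
    (m : InfinitePlace K → ℕ) :
    Measurable fun y : (mixedSpace K)ˣ => placeWeight K m (y : mixedSpace K) *
      ENNReal.ofReal (‖(smoothedVector W (dilAtom g θ y) f : (AdelicGroupData.gl 2 K).L2 μ)‖ ^ 2) :=
  (measurable_placeWeight_units m).mul ((continuous_smoothedVector_dilAtom W hg hgs hθ f).norm.pow 2).measurable.ennreal_ofReal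


/-! ### Words -/

/-- Concatenation of words: `wordDerivWeight (w₁ ++ w₂) θ = wordDerivWeight w₁ (wordDerivWeight w₂ θ)`. [folklore] -/
theorem wordDerivWeight_append {n : ℕ} (hcpt : isCompact_glFiniteIntegralLevel n K) (θ : GL (Fin n) (AdeleRing (𝓞 K) K) → ℝ)
    (w₂ : List (AutomorphyDatum.gl n K hcpt).arch.lie) :
    ∀ w₁ : List (AutomorphyDatum.gl n K hcpt).arch.lie,
      wordDerivWeight (AutomorphyDatum.gl n K hcpt).ofArch (w₁ ++ w₂) θ =
        wordDerivWeight (AutomorphyDatum.gl n K hcpt).ofArch w₁ (wordDerivWeight (AutomorphyDatum.gl n K hcpt).ofArch w₂ θ)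
  | [] => rfl
  | X :: w₁ => by rw [List.cons_append, wordDerivWeight_cons, wordDerivWeight_cons, wordDerivWeight_append hcpt θ w₂ w₁]

/-! ### The Kirillov `L²`-bound -/

section Main

set_option maxHeartbeats 4000000 in
/-- **The Kirillov `L²`-bound along the archimedean torus** (soft form of the archimedean
square-integrability of Jacquet–Shalika (1981), §4, for `GL_2`). For `U₀ ≤ GL_2(𝔸_{K,f})` compact
open there are a finite constant `C` and a finite set `𝒰` of archimedean words such that for every
closed subrepresentation `W ≤ L²`, every test function `θ` left-invariant under `(1, U₀)` and every
`f ∈ W`,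
`∫_{K_∞ˣ} |W_{S_θ f}(a(y))|² d^×y ≤ C ∑_{u ∈ 𝒰} ‖S_{θ_u} f‖²`
(global Whittaker coefficient for Tate's character and box, any Haar measure on `N_2(𝔸_K)` for the Borel
structure induced from `GL_2(𝔸_K)`, as in `norm_whittakerCoeff_sum_invQuot_smoothedForm_le`; `a(y) = (diag(y,1),1)`).
[cite: JacquetShalikaAJM1981, §4] [cite: Bump1997, §2.8] -/
theorem exists_lintegral_norm_sq_whittakerCoeff_archDilation_le
    [MeasurableSpace (GL (Fin 2) (AdeleRing (𝓞 K) K))] [BorelSpace (GL (Fin 2) (AdeleRing (𝓞 K) K))]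
    (ν₀ : Measure ↥(adelicUnipotent 2 K)) [Measure.IsHaarMeasure ν₀]
    (U₀ : Subgroup (GL (Fin 2) (FiniteAdeleRing (𝓞 K) K))) (hU₀o : IsOpen (U₀ : Set (GL (Fin 2) (FiniteAdeleRing (𝓞 K) K))))
    (hU₀c : IsCompact (U₀ : Set (GL (Fin 2) (FiniteAdeleRing (𝓞 K) K)))) :
    ∃ (C : ℝ≥0∞) (_ : C ≠ ⊤) (𝒰 : Finset (List (AutomorphyDatum.gl 2 K (isCompact_glFiniteIntegralLevel_holds 2 K)).arch.lie)),
      ∀ (W : ContRepresentation.ClosedSubrep ((AdelicGroupData.gl 2 K).rightRegular μ))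
        (θ : GL (Fin 2) (AdeleRing (𝓞 K) K) → ℝ), IsTestFunctionGL 2 K θ →
        (∀ u ∈ U₀, ∀ g : GL (Fin 2) (AdeleRing (𝓞 K) K), θ (GLn.ofFinite 2 K u * g) = θ g) → ∀ f : W.toSubmodule,
          ∫⁻ y, ‖whittakerCoeff ν₀ (unipotentTateDomain 2 K) (adeleAddChar K)
              (invQuot (AdelicGroupData.gl 2 K) (smoothedForm θ (f : (AdelicGroupData.gl 2 K).L2 μ))) (archDilationGL K y)‖ₑ ^ 2 ∂mixedUnitsHaar K ≤
            C * ∑ u ∈ 𝒰, ENNReal.ofReal (‖(smoothedVector W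
              (wordDerivWeight (AutomorphyDatum.gl 2 K (isCompact_glFiniteIntegralLevel_holds 2 K)).ofArch u θ) f :
                (AdelicGroupData.gl 2 K).L2 μ)‖ ^ 2) := by
  have hc : isCompact_glFiniteIntegralLevel 2 K := isCompact_glFiniteIntegralLevel_holds 2 K
  -- (a) the Sobolev bound of the Whittaker functional at `1`
  obtain ⟨C₁, 𝒮, hC₁, hbound⟩ := norm_whittakerCoeff_sum_invQuot_smoothedForm_le (μ := μ) U₀ hU₀o hU₀c
  set L : ℕ := 𝒮.sup List.length with hL
  have hlen : ∀ w ∈ 𝒮, w.length ≤ L := fun w hw => Finset.le_sup (f := List.length) hw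
  -- (b) the admissible kernel
  obtain ⟨g₀, hg₀, hĝ₀⟩ := exists_isMomentKernelGE_kernelTransform_one_ne_zero (K := K) (L + 1 + 2 * L)
  have hg₀c : Continuous g₀ := hg₀.continuous
  have hg₀s : HasCompactSupport g₀ := hg₀.hasCompactSupport
  set κ : ℝ := ‖kernelTransform K g₀ 1‖⁻¹ with hκ
  have hκ0 : 0 ≤ κ := inv_nonneg.2 (norm_nonneg _)
  -- (c) representation data of the words of `𝒮`, uniformly in `θ`
  have hrep : ∀ w : ↥𝒮, IsDilRepresentable hc (L + 1) w.1.length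
      (fun θ y => wordDerivWeight (AutomorphyDatum.gl 2 K hc).ofArch w.1 (dilAtom g₀ θ y)) :=
    fun w => isDilRepresentable_wordDerivWeight_dilAtom (hcpt := hc) w.1 (hg₀.mono (by have := hlen w.1 w.2; omega))
  choose ι hι T hT hid using hrep
  -- coefficient constants
  have hcoef : ∀ (w : ↥𝒮) (i : ι w), ∃ Cc : ℝ, 0 ≤ Cc ∧ ∀ y, |(T w i).coeff y| ≤ Cc * torusMonomial (T w i).expo y := by
    intro w i
    obtain ⟨C, hC⟩ := (hT w i).1
    exact ⟨max C 0, le_max_right _ _, fun y => (hC y).trans (mul_le_mul_of_nonneg_right (le_max_left _ _) (torusMonomial_nonneg _ _))⟩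
  choose Cc hCc0 hCc using hcoef
  -- kernel orders
  have hker : ∀ (w : ↥𝒮) (i : ι w), ∃ k : InfinitePlace K → ℕ, (∀ v, (T w i).expo v + 1 ≤ k v) ∧ IsMomentKernel K k (T w i).kernel := by
    intro w i
    obtain ⟨k, hk, hgk⟩ := (hT w i).2.2
    exact ⟨k, fun v => by have h1 := (hT w i).2.1 v; have h2 := hlen w.1 w.2; have h3 := hk v; omega, hgk⟩
  choose kk hkk hker' using hker
  -- (d) the constants
  set Cdil : ∀ w : ↥𝒮, ι w → ℝ≥0∞ := fun w i => ∫⁻ z, placeWeight K (2 • (T w i).expo) (z : mixedSpace K) *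
    ENNReal.ofReal (‖kernelTransform K (T w i).kernel (((z⁻¹ : (mixedSpace K)ˣ) : mixedSpace K))‖ ^ 2) ∂mixedUnitsHaar K with hCdil
  have hCdil_lt : ∀ w i, Cdil w i < ⊤ := fun w i => (hker' w i).lintegral_dilationConstant_lt_top (hkk w i)
  set Amom : ∀ w : ↥𝒮, ι w → ℝ≥0∞ := fun w i => max 1 (ENNReal.ofReal ((3 * (2 * π)⁻¹) ^ (2 * ∑ v, (T w i).expo v) *
    ((coordDirs K).card : ℝ) ^ (2 * ∑ v, (T w i).expo v - 1))) * ((coordDirs K).card + 1) with hAmom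
  have hAmom_lt : ∀ w i, Amom w i < ⊤ := fun w i =>
    ENNReal.mul_lt_top (max_lt ENNReal.one_lt_top ENNReal.ofReal_lt_top) (ENNReal.add_lt_top.2 ⟨ENNReal.natCast_lt_top _, ENNReal.one_lt_top⟩)
  -- (e) the word set and the constant
  set 𝒰 : Finset (List (AutomorphyDatum.gl 2 K hc).arch.lie) := 𝒮.attach.biUnion fun w => (Finset.univ : Finset (ι w)).biUnion fun i =>
    insert (T w i).word ((coordDirs K).image fun e => List.replicate (∑ v, (T w i).expo v) (unipotentLetter hc e) ++ (T w i).word) with h𝒰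
  have hmem_word : ∀ (w : ↥𝒮) (i : ι w), (T w i).word ∈ 𝒰 := fun w i =>
    Finset.mem_biUnion.2 ⟨w, Finset.mem_attach _ _, Finset.mem_biUnion.2 ⟨i, Finset.mem_univ _, Finset.mem_insert_self _ _⟩⟩
  have hmem_rep : ∀ (w : ↥𝒮) (i : ι w), ∀ e ∈ coordDirs K,
      List.replicate (∑ v, (T w i).expo v) (unipotentLetter hc e) ++ (T w i).word ∈ 𝒰 := fun w i e he =>
    Finset.mem_biUnion.2 ⟨w, Finset.mem_attach _ _, Finset.mem_biUnion.2 ⟨i, Finset.mem_univ _,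
      Finset.mem_insert_of_mem (Finset.mem_image.2 ⟨e, he, rfl⟩)⟩⟩
  set cst : ∀ w : ↥𝒮, ι w → ℝ := fun w i => (κ * C₁) ^ 2 * 𝒮.card * Fintype.card (ι w) * (Cc w i) ^ 2 with hcst
  have hcst0 : ∀ w i, 0 ≤ cst w i := fun w i => by positivity
  set C : ℝ≥0∞ := ∑ w ∈ 𝒮.attach, ∑ i : ι w, ENNReal.ofReal (cst w i) * Cdil w i * Amom w i with hC
  have hCfin : C ≠ ⊤ := by
    refine (ENNReal.sum_lt_top.2 fun w _ => ENNReal.sum_lt_top.2 fun i _ => ?_).ne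
    exact ENNReal.mul_lt_top (ENNReal.mul_lt_top ENNReal.ofReal_lt_top (hCdil_lt w i)) (hAmom_lt w i)
  refine ⟨C, hCfin, 𝒰, fun W θ hθ hθU f => ?_⟩
  -- notation for the fixed vectors and the atoms
  set vv : ∀ w : ↥𝒮, ι w → (AdelicGroupData.gl 2 K).L2 μ := fun w i =>
    (smoothedVector W (wordDerivWeight (AutomorphyDatum.gl 2 K hc).ofArch (T w i).word θ) f : (AdelicGroupData.gl 2 K).L2 μ) with hvv
  have hθw : ∀ (w : ↥𝒮) (i : ι w), IsTestFunctionGL 2 K (wordDerivWeight (AutomorphyDatum.gl 2 K hc).ofArch (T w i).word θ) := fun w i =>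
    isTestFunctionGL_wordDerivWeight' hc hθ _
  set SU : ℝ≥0∞ := ∑ u ∈ 𝒰, ENNReal.ofReal (‖(smoothedVector W (wordDerivWeight (AutomorphyDatum.gl 2 K hc).ofArch u θ) f :
    (AdelicGroupData.gl 2 K).L2 μ)‖ ^ 2) with hSU
  -- (f) moments of the fixed vectors
  have hmom : ∀ (w : ↥𝒮) (i : ι w), ∫⁻ ξ, placeWeight K (2 • (T w i).expo) ξ ∂(lineSpectralMeasure (μ := μ) (vv w i)) ≤ Amom w i * SU := by
    intro w i
    have h1A : 1 ≤ Amom w i := by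
      rw [hAmom]
      calc (1 : ℝ≥0∞) = 1 * 1 := (one_mul _).symm
        _ ≤ _ := mul_le_mul' (le_max_left _ _) (by exact_mod_cast Nat.le_add_left 1 _)
    rcases Nat.eq_zero_or_pos (∑ v, (T w i).expo v) with h0 | hpos
    · -- order zero: the moment is `‖v‖²`
      have hexpo : (T w i).expo = 0 := by
        funext v; exact (Finset.sum_eq_zero_iff.1 h0) v (Finset.mem_univ v)
      rw [hexpo, lintegral_placeWeight_zero_spectralMeasure]
      calc ENNReal.ofReal (‖vv w i‖ ^ 2) ≤ SU := by
            rw [hSU]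
            exact Finset.single_le_sum (f := fun u => ENNReal.ofReal (‖(smoothedVector W
              (wordDerivWeight (AutomorphyDatum.gl 2 K hc).ofArch u θ) f : (AdelicGroupData.gl 2 K).L2 μ)‖ ^ 2))
              (fun u _ => bot_le) (hmem_word w i)
        _ ≤ Amom w i * SU := le_mul_of_one_le_left bot_le h1A
    · -- positive order
      have h := lintegral_placeWeight_spectralMeasure_smoothedVector_le hc W (hθw w i) f (T w i).expo hpos
      refine h.trans ?_
      have hterm : ∀ e ∈ coordDirs K, ENNReal.ofReal (‖(smoothedVector W (wordDerivWeight (AutomorphyDatum.gl 2 K hc).ofArch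
          (List.replicate (∑ v, (T w i).expo v) (unipotentLetter hc e)) (wordDerivWeight (AutomorphyDatum.gl 2 K hc).ofArch (T w i).word θ)) f :
            (AdelicGroupData.gl 2 K).L2 μ)‖ ^ 2) ≤ SU := by
        intro e he
        rw [← wordDerivWeight_append hc θ, hSU]
        exact Finset.single_le_sum (f := fun u => ENNReal.ofReal (‖(smoothedVector W
          (wordDerivWeight (AutomorphyDatum.gl 2 K hc).ofArch u θ) f : (AdelicGroupData.gl 2 K).L2 μ)‖ ^ 2))
          (fun u _ => bot_le) (hmem_rep w i e he)
      calc _ ≤ ENNReal.ofReal ((3 * (2 * π)⁻¹) ^ (2 * ∑ v, (T w i).expo v) * ((coordDirs K).card : ℝ) ^ (2 * ∑ v, (T w i).expo v - 1)) *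
            ((coordDirs K).card • SU) := by
            gcongr
            exact Finset.sum_le_card_nsmul _ _ _ hterm
        _ ≤ Amom w i * SU := by
            rw [nsmul_eq_mul, ← mul_assoc]
            refine mul_le_mul' ?_ le_rfl
            show ENNReal.ofReal _ * ((coordDirs K).card : ℝ≥0∞) ≤ max 1 (ENNReal.ofReal _) * ((coordDirs K).card + 1 : ℝ≥0∞)
            exact mul_le_mul' (le_max_right _ _) le_self_add
  -- (g) the pointwise bound along the torus
  have hpt : ∀ y : (mixedSpace K)ˣ,
      ‖whittakerCoeff ν₀ (unipotentTateDomain 2 K) (adeleAddChar K)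
          (invQuot (AdelicGroupData.gl 2 K) (smoothedForm θ (f : (AdelicGroupData.gl 2 K).L2 μ))) (archDilationGL K y)‖ₑ ^ 2 ≤
        ∑ w ∈ 𝒮.attach, ∑ i : ι w, ENNReal.ofReal (cst w i) *
          (placeWeight K (2 • (T w i).expo) (y : mixedSpace K) *
            ENNReal.ofReal (‖(smoothedVector W (dilAtom (T w i).kernel
              (wordDerivWeight (AutomorphyDatum.gl 2 K hc).ofArch (T w i).word θ) y) f : (AdelicGroupData.gl 2 K).L2 μ)‖ ^ 2)) := by
    intro y
    -- the translate, the atom of `g₀` and its invariance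
    have hηt : IsTestFunctionGL 2 K (leftTranslateWeight (n := 2) (archDilationAdelic K y) θ) := hθ.leftTranslate _
    have hat : IsTestFunctionGL 2 K (dilAtom g₀ θ y) := isTestFunctionGL_dilAtom hg₀.contDiff hg₀s hθ y
    have hatU : ∀ u ∈ U₀, ∀ g : GL (Fin 2) (AdeleRing (𝓞 K) K), dilAtom g₀ θ y (GLn.ofFinite 2 K u * g) = dilAtom g₀ θ y g :=
      fun u hu g => dilAtom_ofFinite_mul hθU g₀ y u hu g
    -- (1)+(2): `W(a(y)) = Λ(S_{L_a θ} f) = ĝ₀(1)⁻¹ Λ(S_{g₀ ⋆ L_a θ} f)`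
    have e1 : whittakerCoeff ν₀ (unipotentTateDomain 2 K) (adeleAddChar K)
        (invQuot (AdelicGroupData.gl 2 K) (smoothedForm θ (f : (AdelicGroupData.gl 2 K).L2 μ))) (archDilationGL K y) =
        whittakerCoeff ν₀ (unipotentTateDomain 2 K) (adeleAddChar K)
          (invQuot (AdelicGroupData.gl 2 K) (smoothedForm (leftTranslateWeight (n := 2) (archDilationAdelic K y) θ)
            (f : (AdelicGroupData.gl 2 K).L2 μ))) 1 := by
      have h := whittakerCoeff_invQuot_smoothedForm_mul (μ := μ) ν₀ (unipotentTateDomain 2 K) (adeleAddChar K) θ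
        (f : (AdelicGroupData.gl 2 K).L2 μ) 1 (archDilationAdelic K y)
      rw [one_mul] at h
      exact h
    have e2 := whittakerCoeff_smoothedForm_archUnipotentConv (μ := μ) ν₀ hg₀c hg₀s hηt.continuous hηt.hasCompactSupport
      (f : (AdelicGroupData.gl 2 K).L2 μ)
    have hnorm1 : ‖whittakerCoeff ν₀ (unipotentTateDomain 2 K) (adeleAddChar K)
        (invQuot (AdelicGroupData.gl 2 K) (smoothedForm θ (f : (AdelicGroupData.gl 2 K).L2 μ))) (archDilationGL K y)‖ =
        κ * ‖whittakerCoeff ν₀ (unipotentTateDomain 2 K) (adeleAddChar K)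
          (invQuot (AdelicGroupData.gl 2 K) (smoothedForm (dilAtom g₀ θ y) (f : (AdelicGroupData.gl 2 K).L2 μ))) 1‖ := by
      rw [e1]
      have h3 : whittakerCoeff ν₀ (unipotentTateDomain 2 K) (adeleAddChar K)
          (invQuot (AdelicGroupData.gl 2 K) (smoothedForm (leftTranslateWeight (n := 2) (archDilationAdelic K y) θ)
            (f : (AdelicGroupData.gl 2 K).L2 μ))) 1 =
          (kernelTransform K g₀ 1)⁻¹ * whittakerCoeff ν₀ (unipotentTateDomain 2 K) (adeleAddChar K)
            (invQuot (AdelicGroupData.gl 2 K) (smoothedForm (dilAtom g₀ θ y) (f : (AdelicGroupData.gl 2 K).L2 μ))) 1 := by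
        rw [show dilAtom g₀ θ y = archUnipotentConv g₀ (leftTranslateWeight (n := 2) (archDilationAdelic K y) θ) from rfl, e2, ← mul_assoc,
          inv_mul_cancel₀ hĝ₀, one_mul]
      rw [h3, norm_mul, norm_inv]
    -- (3) the Sobolev bound of the Whittaker functional
    have e3 := hbound W ({()} : Finset Unit) (fun _ => f) (fun _ => dilAtom g₀ θ y) (fun _ _ => hat) (fun _ _ => hatU) ν₀ (adeleAddChar K)
    simp only [Finset.sum_singleton] at e3
    -- (4) each word of `𝒮`: expansion and the coefficient bounds
    have e4 : ∀ w : ↥𝒮, ‖smoothedVector W (wordDerivWeight (AutomorphyDatum.gl 2 K hc).ofArch w.1 (dilAtom g₀ θ y)) f‖ ≤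
        ∑ i : ι w, Cc w i * torusMonomial (T w i).expo y *
          ‖(smoothedVector W (dilAtom (T w i).kernel (wordDerivWeight (AutomorphyDatum.gl 2 K hc).ofArch (T w i).word θ) y) f :
            (AdelicGroupData.gl 2 K).L2 μ)‖ := by
      intro w
      have hidw := hid w θ hθ y
      dsimp only at hidw
      have hati : ∀ i : ι w, IsTestFunctionGL 2 K (dilAtom (T w i).kernel (wordDerivWeight (AutomorphyDatum.gl 2 K hc).ofArch (T w i).word θ) y) :=
        fun i => isTestFunctionGL_dilAtom (hT w i).2.2.contDiff (hT w i).2.2.hasCompactSupport (hθw w i) y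
      have hci : ∀ i : ι w, Continuous ((T w i).eval hc θ y) := fun i => (hati i).continuous.const_smul ((T w i).coeff y)
      have hsi : ∀ i : ι w, HasCompactSupport ((T w i).eval hc θ y) := fun i =>
        (hati i).hasCompactSupport.mono (Function.support_const_smul_subset ((T w i).coeff y) _)
      have hsum : smoothedVector W (wordDerivWeight (AutomorphyDatum.gl 2 K hc).ofArch w.1 (dilAtom g₀ θ y)) f =
          ∑ i : ι w, smoothedVector W ((T w i).eval hc θ y) f := by
        rw [hidw]
        have h := smoothedVector_finset_sum_weight (W := W) (Finset.univ : Finset (ι w)) (η := fun i => (T w i).eval hc θ y) hci hsi f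
        rwa [← Finset.sum_fn] at h
      rw [hsum]
      refine (norm_sum_le _ _).trans (Finset.sum_le_sum fun i _ => ?_)
      have hsm : smoothedVector W ((T w i).eval hc θ y) f =
          ((T w i).coeff y : ℂ) • smoothedVector W (dilAtom (T w i).kernel (wordDerivWeight (AutomorphyDatum.gl 2 K hc).ofArch (T w i).word θ) y) f :=
        smoothedVector_smul_weight W ((T w i).coeff y) _ f
      rw [hsm, _root_.norm_smul, Complex.norm_real, Real.norm_eq_abs, Submodule.coe_norm]
      exact mul_le_mul_of_nonneg_right (hCc w i y) (norm_nonneg _)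
    -- (5) the real inequality
    set b : ∀ w : ↥𝒮, ι w → ℝ := fun w i => Cc w i * torusMonomial (T w i).expo y *
      ‖(smoothedVector W (dilAtom (T w i).kernel (wordDerivWeight (AutomorphyDatum.gl 2 K hc).ofArch (T w i).word θ) y) f :
        (AdelicGroupData.gl 2 K).L2 μ)‖ with hb
    have hb0 : ∀ w i, 0 ≤ b w i := fun w i => mul_nonneg (mul_nonneg (hCc0 w i) (torusMonomial_nonneg _ _)) (norm_nonneg _)
    have hA : ‖whittakerCoeff ν₀ (unipotentTateDomain 2 K) (adeleAddChar K)
        (invQuot (AdelicGroupData.gl 2 K) (smoothedForm θ (f : (AdelicGroupData.gl 2 K).L2 μ))) (archDilationGL K y)‖ ≤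
        κ * C₁ * ∑ w ∈ 𝒮.attach, ∑ i : ι w, b w i := by
      rw [hnorm1, mul_assoc]
      refine mul_le_mul_of_nonneg_left (e3.trans (mul_le_mul_of_nonneg_left ?_ hC₁)) hκ0
      rw [← Finset.sum_attach]
      exact Finset.sum_le_sum fun w _ => e4 w
    have hB : (∑ w ∈ 𝒮.attach, ∑ i : ι w, b w i) ^ 2 ≤ ∑ w ∈ 𝒮.attach, (𝒮.card : ℝ) * (Fintype.card (ι w) * ∑ i : ι w, (b w i) ^ 2) := by
      refine (sq_sum_le_card_mul_sum_sq (s := 𝒮.attach) (f := fun w => ∑ i : ι w, b w i)).trans ?_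
      rw [Finset.card_attach, Finset.mul_sum]
      refine Finset.sum_le_sum fun w _ => mul_le_mul_of_nonneg_left ?_ (Nat.cast_nonneg _)
      have h := sq_sum_le_card_mul_sum_sq (s := (Finset.univ : Finset (ι w))) (f := fun i => b w i)
      rwa [Finset.card_univ] at h
    have hA2 : ‖whittakerCoeff ν₀ (unipotentTateDomain 2 K) (adeleAddChar K)
        (invQuot (AdelicGroupData.gl 2 K) (smoothedForm θ (f : (AdelicGroupData.gl 2 K).L2 μ))) (archDilationGL K y)‖ ^ 2 ≤
        ∑ w ∈ 𝒮.attach, ∑ i : ι w, cst w i * (torusMonomial (2 • (T w i).expo) y *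
          ‖(smoothedVector W (dilAtom (T w i).kernel (wordDerivWeight (AutomorphyDatum.gl 2 K hc).ofArch (T w i).word θ) y) f :
            (AdelicGroupData.gl 2 K).L2 μ)‖ ^ 2) := by
      have hsq : ‖whittakerCoeff ν₀ (unipotentTateDomain 2 K) (adeleAddChar K)
          (invQuot (AdelicGroupData.gl 2 K) (smoothedForm θ (f : (AdelicGroupData.gl 2 K).L2 μ))) (archDilationGL K y)‖ ^ 2 ≤
          (κ * C₁) ^ 2 * (∑ w ∈ 𝒮.attach, ∑ i : ι w, b w i) ^ 2 := by
        rw [← mul_pow]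
        exact pow_le_pow_left₀ (norm_nonneg _) hA 2
      refine hsq.trans ((mul_le_mul_of_nonneg_left hB (sq_nonneg _)).trans (le_of_eq ?_))
      rw [Finset.mul_sum]
      refine Finset.sum_congr rfl fun w _ => ?_
      rw [Finset.mul_sum, Finset.mul_sum, Finset.mul_sum]
      refine Finset.sum_congr rfl fun i _ => ?_
      rw [hcst, hb]
      simp only []
      rw [two_nsmul, torusMonomial_add]
      ring
    -- (6) in `ℝ≥0∞`
    rw [← ofReal_norm, ← ENNReal.ofReal_pow (norm_nonneg _)]
    refine (ENNReal.ofReal_le_ofReal hA2).trans (le_of_eq ?_)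
    rw [ENNReal.ofReal_sum_of_nonneg fun w _ => Finset.sum_nonneg fun i _ =>
      mul_nonneg (hcst0 w i) (mul_nonneg (torusMonomial_nonneg _ _) (sq_nonneg _))]
    refine Finset.sum_congr rfl fun w _ => ?_
    rw [ENNReal.ofReal_sum_of_nonneg fun i _ => mul_nonneg (hcst0 w i) (mul_nonneg (torusMonomial_nonneg _ _) (sq_nonneg _))]
    refine Finset.sum_congr rfl fun i _ => ?_
    rw [ENNReal.ofReal_mul (hcst0 w i), ENNReal.ofReal_mul (torusMonomial_nonneg _ _), placeWeight_eq_ofReal]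
    rfl
  -- (h) integrate
  calc ∫⁻ y, ‖whittakerCoeff ν₀ (unipotentTateDomain 2 K) (adeleAddChar K)
          (invQuot (AdelicGroupData.gl 2 K) (smoothedForm θ (f : (AdelicGroupData.gl 2 K).L2 μ))) (archDilationGL K y)‖ₑ ^ 2 ∂mixedUnitsHaar K
      ≤ ∫⁻ y, ∑ w ∈ 𝒮.attach, ∑ i : ι w, ENNReal.ofReal (cst w i) *
          (placeWeight K (2 • (T w i).expo) (y : mixedSpace K) *
            ENNReal.ofReal (‖(smoothedVector W (dilAtom (T w i).kernel
              (wordDerivWeight (AutomorphyDatum.gl 2 K hc).ofArch (T w i).word θ) y) f : (AdelicGroupData.gl 2 K).L2 μ)‖ ^ 2)) ∂mixedUnitsHaar K :=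
        lintegral_mono hpt
    _ = ∑ w ∈ 𝒮.attach, ∑ i : ι w, ENNReal.ofReal (cst w i) * ∫⁻ y, placeWeight K (2 • (T w i).expo) (y : mixedSpace K) *
            ENNReal.ofReal (‖(smoothedVector W (dilAtom (T w i).kernel
              (wordDerivWeight (AutomorphyDatum.gl 2 K hc).ofArch (T w i).word θ) y) f : (AdelicGroupData.gl 2 K).L2 μ)‖ ^ 2) ∂mixedUnitsHaar K := by
        have hm : ∀ (w : ↥𝒮) (i : ι w), Measurable fun y : (mixedSpace K)ˣ => placeWeight K (2 • (T w i).expo) (y : mixedSpace K) *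
            ENNReal.ofReal (‖(smoothedVector W (dilAtom (T w i).kernel
              (wordDerivWeight (AutomorphyDatum.gl 2 K hc).ofArch (T w i).word θ) y) f : (AdelicGroupData.gl 2 K).L2 μ)‖ ^ 2) := fun w i =>
          measurable_placeWeight_mul_norm_sq_smoothedVector_dilAtom W (hker' w i).continuous (hker' w i).hasCompactSupport (hθw w i) f _
        rw [lintegral_finsetSum _ fun w _ => Finset.measurable_sum _ fun i _ => (hm w i).const_mul _]
        refine Finset.sum_congr rfl fun w _ => ?_
        rw [lintegral_finsetSum _ fun i _ => (hm w i).const_mul _]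
        refine Finset.sum_congr rfl fun i _ => ?_
        rw [lintegral_const_mul _ (hm w i)]
    _ ≤ ∑ w ∈ 𝒮.attach, ∑ i : ι w, ENNReal.ofReal (cst w i) * (Cdil w i * (Amom w i * SU)) := by
        gcongr with w _ i _
        exact (lintegral_placeWeight_mul_norm_sq_smoothedVector_dilAtom_le W (hker' w i) (hkk w i) (hθw w i) f).trans
          (mul_le_mul' le_rfl (hmom w i))
    _ = C * SU := by
        rw [hC, Finset.sum_mul]
        refine Finset.sum_congr rfl fun w _ => ?_
        rw [Finset.sum_mul]
        refine Finset.sum_congr rfl fun i _ => ?_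
        ring

end Main

end Literature.NumberTheory.Automorphic
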